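import Summits.FinalStateConjecture.FinalStateConjecture.Theorems.DerivativeThriftThriftyHandoffDefs
import Literature.Geometry.Lorentzian.LeafAdaptedModelChartsMinkowski
import Literature.Geometry.Lorentzian.CauchyDevelopmentCausal
import Literature.Geometry.Lorentzian.StationaryOrbitRelation
import HarnessLib

/-!
# `ThriftyHandoff` (stmt-FinalStateConjecture-17612), line `registered`: ANTI-VACUITY of the thrifty
# hand-over — the Minkowski development admits exact `0`-hole thrifty layers (`𝔑 = 0`)

The hand-over clause (iii) of the crux `DerivativeThrift.ThriftyHandoff` (`FullHandoff`, and a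
fortiori the conclusion `WeakHandoff` of the line's hardest stub `stub_censoredCapture`) asks, for
every scale `ℓ > 0`, accuracy `ε > 0` and lab time `τ₁`, for a lab time `τ ≥ τ₁` and a smooth open
embedding `Φ` of the `N`-hole hyperboloidal layer `RecedingKerr.layer M a Λ ξ τ ℓ` into `J⁺(ιX)`
with achronal leaves and `k = 2` layer norm `𝔑_(2,1/2,1/2)(Φ) ≤ ε`. Until now no theorem of the
tree produced ANY `RecedingKerr.layer` chart of finite layer norm in any vacuum Cauchy development
(wave-1 findings of the line, 2026-08-17). This file proves the dispersive (`N = 0`) instance at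
the model: in the Minkowski development `Minkowski.vacuumCauchyDevelopment` of the trivial datum
`(ℝ³, δ, 0)` the INCLUSION of the `0`-hole layer `{0 < s < ℓ}`, `s = x⁰ − τ − (√(ℓ² + |x̲|²) − ℓ)`,
at any lab time `τ ≥ 0`, is such a chart with `𝔑 = 0` EXACTLY:

* its deviation from the layer background (`= η` for `N = 0`, `RecedingKerr.background_bilin_of_isEmpty`)
  vanishes identically (`dι = id`, `OpensChart.mfderiv_subtypeVal_apply`), so all three parts of the
  norm vanish (`nearCkNorm_zero`, `rpFlux_zero`, `transversalFlux_zero`);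
* the layer lies in `{x⁰ > τ} ⊆ {x⁰ ≥ 0} = J⁺({x⁰ = 0})` (`Minkowski.causalFuture_singleton`);
* its leaves `{s = s₀}` are the hyperboloids `{x⁰ = τ + s₀ − ℓ + √(ℓ² + |x̲|²)}`, ACHRONAL: for
  `q, q'` on one of them, `q' ∈ I⁺(q) ⊆ J⁺(q)` gives `‖q̲' − q̲‖ ≤ q'⁰ − q⁰ = √(ℓ²+|q̲'|²) − √(ℓ²+|q̲|²)
  ≤ |‖q̲'‖ − ‖q̲‖| ≤ ‖q̲' − q̲‖`, and the middle inequality is strict off `‖q̲'‖ = ‖q̲‖` (`ℓ > 0`), so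
  `q' = q`, contradicting chronology (`CauchyDevelopment.isChronological`) — the argument of
  `BartnikGapSettlingCaptureStubMinkowskiSoundLeaf.isAchronal_hyperboloid` at scale `ℓ`.

Hence `fullHandoff_minkowski : FullHandoff Minkowski.vacuumCauchyDevelopment` (sub-extremality,
orthochronicity, distinct velocities and centre separation are `Fin 0`-vacuous) and
`weakHandoff_minkowski`. This is a sanity certificate, not progress on the crux: it shows the
hand-over currency of the route (`RecedingKerr.layer`, `Spacetime.recedingKerrInitialLayerNorm`) is
inhabited in the intended dispersive way — the antecedent of `DerivativeThrift.ThriftyClusterSettling`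
and the conclusion of `stub_censoredCapture` hold at the model development (whose maximality is not
claimed here) — so neither is refutable by a typing slip of the layer clause. Hawking–Ellis 1973,
§5.1 (Minkowski space); O'Neill 1983, Ch. 14, p. 402 (cones) and p. 413 (achronal sets);
Klainerman–Szeftel arXiv:2104.11857, §3.1 (initial data layer).
-/

noncomputable section

-- D-0017: single-problem summit, `Summit.<S>.<S>.…` by design.
set_option linter.dupNamespace false

open Set Function Filter TopologicalSpace
open scoped Manifold ContDiff Topology ENNReal

namespace Summit.FinalStateConjecture.FinalStateConjecture.Theorems.DerivativeThriftThriftyHandoff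

open Literature.Geometry.Lorentzian

variable (M a : Fin 0 → ℝ) (Λ : Fin 0 → lorentzGroup) (ξ : Fin 0 → E3) (τ ℓ : ℝ)

/-! ### §1 The `0`-hole layer: elementary inequalities -/

/-- `ℓ ≤ √(ℓ² + r²)`. [folklore] -/
theorem le_sqrt_sq_add_sq (ℓ r : ℝ) : ℓ ≤ √(ℓ ^ 2 + r ^ 2) :=
  Real.le_sqrt_of_sq_le (by nlinarith)

/-- `|r| ≤ √(ℓ² + r²)`. [folklore] -/
theorem abs_le_sqrt_sq_add_sq (ℓ r : ℝ) : |r| ≤ √(ℓ ^ 2 + r ^ 2) :=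
  Real.abs_le_sqrt (by nlinarith)

/-- The scale-`ℓ` hyperboloid profile `r ↦ √(ℓ² + r²)` is `1`-Lipschitz:
`|√(ℓ² + s²) − √(ℓ² + t²)| ≤ |s − t|`. O'Neill 1983, Ch. 14, p. 413 (hyperboloids are spacelike,
hence locally `1`-Lipschitz graphs). [folklore] -/
theorem abs_sqrt_sq_add_sq_sub_le (ℓ s t : ℝ) :
    |√(ℓ ^ 2 + s ^ 2) - √(ℓ ^ 2 + t ^ 2)| ≤ |s - t| := by
  set A := √(ℓ ^ 2 + s ^ 2) with hA
  set B := √(ℓ ^ 2 + t ^ 2) with hB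
  have hA0 : 0 ≤ A := Real.sqrt_nonneg _
  have hB0 : 0 ≤ B := Real.sqrt_nonneg _
  have hAs : |s| ≤ A := abs_le_sqrt_sq_add_sq ℓ s
  have hBt : |t| ≤ B := abs_le_sqrt_sq_add_sq ℓ t
  have hA2 : A ^ 2 = ℓ ^ 2 + s ^ 2 := Real.sq_sqrt (by positivity)
  have hB2 : B ^ 2 = ℓ ^ 2 + t ^ 2 := Real.sq_sqrt (by positivity)
  by_cases hsum : A + B = 0
  · have hA' : A = 0 := by linarith
    have hB' : B = 0 := by linarith
    rw [hA', hB', sub_self, abs_zero]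
    exact abs_nonneg _
  have hpos : 0 < A + B := lt_of_le_of_ne (add_nonneg hA0 hB0) (Ne.symm hsum)
  -- `(A - B)(A + B) = (s - t)(s + t)` and `|s + t| ≤ A + B`
  have hprod : (A - B) * (A + B) = (s - t) * (s + t) := by nlinarith
  have hst : |s + t| ≤ A + B := (abs_add_le s t).trans (add_le_add hAs hBt)
  have key : |A - B| * (A + B) ≤ |s - t| * (A + B) := by
    calc |A - B| * (A + B) = |(A - B) * (A + B)| := by
          rw [abs_mul, abs_of_pos hpos]
      _ = |s - t| * |s + t| := by rw [hprod, abs_mul]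
      _ ≤ |s - t| * (A + B) := mul_le_mul_of_nonneg_left hst (abs_nonneg _)
  exact le_of_mul_le_mul_right key hpos

/-- Strictness off the diagonal for `ℓ ≠ 0`: if `√(ℓ² + s²) − √(ℓ² + t²) = |s − t|` with `0 ≤ s, t`
then `s = t`. [folklore] -/
theorem eq_of_sqrt_sub_sqrt_eq_abs_sub {ℓ s t : ℝ} (hℓ : ℓ ≠ 0) (hs : 0 ≤ s) (ht : 0 ≤ t)
    (h : √(ℓ ^ 2 + s ^ 2) - √(ℓ ^ 2 + t ^ 2) = |s - t|) : s = t := by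
  by_contra hne
  set A := √(ℓ ^ 2 + s ^ 2) with hA
  set B := √(ℓ ^ 2 + t ^ 2) with hB
  have hA2 : A ^ 2 = ℓ ^ 2 + s ^ 2 := Real.sq_sqrt (by positivity)
  have hB2 : B ^ 2 = ℓ ^ 2 + t ^ 2 := Real.sq_sqrt (by positivity)
  have hℓ2 : 0 < ℓ ^ 2 := by positivity
  have hsA : s < A := (Real.lt_sqrt hs).2 (by nlinarith)
  have htB : t < B := (Real.lt_sqrt ht).2 (by nlinarith)
  have hpos : 0 < |s - t| := abs_pos.2 (sub_ne_zero.2 hne)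
  -- `(A - B)(A + B) = (s - t)(s + t)`, `A - B = |s - t|`, and `s + t < A + B`
  have hprod : (A - B) * (A + B) = (s - t) * (s + t) := by nlinarith
  rw [h] at hprod
  have hlt : |s - t| * (s + t) < |s - t| * (A + B) := mul_lt_mul_of_pos_left (by linarith) hpos
  have hle : |s - t| * (A + B) ≤ |s - t| * (s + t) := by
    rw [hprod]
    have : (s - t) * (s + t) ≤ |s - t| * (s + t) :=
      mul_le_mul_of_nonneg_right (le_abs_self _) (by linarith)
    linarith [this]
  exact lt_irrefl _ (hlt.trans_le hle)

/-- On the `0`-hole layer the lab time coordinate exceeds `τ`: `x ∈ 𝓛 → τ < x⁰` (`s > 0` and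
`√(ℓ² + |x̲|²) ≥ ℓ`, for any sign of `ℓ`). Klainerman–Szeftel arXiv:2104.11857, §3.1. [folklore] -/
theorem lt_apply_zero_of_mem_layer {τ ℓ : ℝ} {x : E4}
    (hx : x ∈ RecedingKerr.layer M a Λ ξ τ ℓ) : τ < x 0 := by
  have h := ((RecedingKerr.mem_layer M a Λ ξ τ ℓ).1 hx).1.1
  unfold RecedingKerr.layerTime at h
  have := le_sqrt_sq_add_sq ℓ (E4.spatialNorm x)
  linarith

/-! ### §2 The inclusion chart of the layer into the Minkowski development -/

/-- **The inclusion of the `0`-hole layer is an exact isometry onto its image**: its deviation from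
the layer background (`η` for `N = 0`) vanishes, since `dι = id` on an open submanifold of `E4`
(`OpensChart.mfderiv_subtypeVal_apply`) and `η` is constant. Hawking–Ellis 1973, §5.1. [folklore] -/
theorem deviation_subtypeVal_layer (x : RecedingKerr.layer M a Λ ξ τ ℓ) :
    Minkowski.vacuumCauchyDevelopment.toSpacetime.deviation (RecedingKerr.background M a Λ ξ τ ℓ)
      (Subtype.val : RecedingKerr.layer M a Λ ξ τ ℓ → E4) x = 0 := by
  ext v w
  change Minkowski.bilin
      (mfderiv 𝓘(ℝ, E4) 𝓘(ℝ, E4) (Subtype.val : RecedingKerr.layer M a Λ ξ τ ℓ → E4) x v)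
      (mfderiv 𝓘(ℝ, E4) 𝓘(ℝ, E4) (Subtype.val : RecedingKerr.layer M a Λ ξ τ ℓ → E4) x w) -
    (RecedingKerr.background M a Λ ξ τ ℓ).bilin x.1 v w = 0
  rw [OpensChart.mfderiv_subtypeVal_apply, OpensChart.mfderiv_subtypeVal_apply,
    RecedingKerr.background_bilin_of_isEmpty, sub_self]

/-- Hence the extended deviation of the inclusion chart is the ZERO FUNCTION on `E4` (on the layer
by the previous lemma, off it by the junk value of `deviationExtend`). [folklore] -/
theorem deviationExtend_subtypeVal_layer :
    Minkowski.vacuumCauchyDevelopment.toSpacetime.deviationExtend (RecedingKerr.background M a Λ ξ τ ℓ)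
      (Subtype.val : RecedingKerr.layer M a Λ ξ τ ℓ → E4) = 0 := by
  funext y
  by_cases hy : y ∈ RecedingKerr.layer M a Λ ξ τ ℓ
  · have := Minkowski.vacuumCauchyDevelopment.toSpacetime.deviationExtend_coe
      (RecedingKerr.background M a Λ ξ τ ℓ)
      (Subtype.val : RecedingKerr.layer M a Λ ξ τ ℓ → E4) ⟨y, hy⟩
    rw [deviation_subtypeVal_layer] at this
    exact this
  · exact Minkowski.vacuumCauchyDevelopment.toSpacetime.deviationExtend_of_not_mem
      (RecedingKerr.background M a Λ ξ τ ℓ) _ hy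

/-- **The layer norm of the inclusion chart vanishes**: `𝔑_(k,p,δ)(ι) = 0` for all exponents
(all three parts are norms of the zero function; `0^{1/2} = 0` in `ℝ≥0∞`). Klainerman–Szeftel
arXiv:2104.11857, §3.6 (exact solutions have vanishing initial layer norm). [folklore] -/
theorem recedingKerrInitialLayerNorm_subtypeVal_layer (k : ℕ) (p δ : ℝ) :
    Minkowski.vacuumCauchyDevelopment.toSpacetime.recedingKerrInitialLayerNorm M a Λ ξ τ ℓ k p δ
      (Subtype.val : RecedingKerr.layer M a Λ ξ τ ℓ → E4) = 0 := by
  rw [Spacetime.recedingKerrInitialLayerNorm_eq, deviationExtend_subtypeVal_layer,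
    RecedingKerr.nearCkNorm_zero, RecedingKerr.rpFlux_zero, RecedingKerr.transversalFlux_zero,
    ENNReal.zero_rpow_of_pos (by norm_num : (0 : ℝ) < 1 / 2), add_zero, add_zero]

/-- **The layer at lab time `τ ≥ 0` lies in `J⁺(ι ℝ³) = {x⁰ ≥ 0}`** of the Minkowski development:
`x⁰ > τ ≥ 0` on the layer and `x` lies vertically above the slice point `(0, x̲)`
(`Minkowski.causalFuture_singleton`). O'Neill 1983, Ch. 14, p. 402. [folklore] -/
theorem range_subtypeVal_layer_subset_causalFuture {τ ℓ : ℝ} (hτ : 0 ≤ τ) :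
    range (Subtype.val : RecedingKerr.layer M a Λ ξ τ ℓ → E4) ⊆
      Minkowski.vacuumCauchyDevelopment.metric.causalFuture
        Minkowski.vacuumCauchyDevelopment.timeOrientation
        (range Minkowski.vacuumCauchyDevelopment.embed) := by
  rintro _ ⟨x, rfl⟩
  have hx0 : 0 ≤ (x : E4) 0 := by
    have := lt_apply_zero_of_mem_layer M a Λ ξ x.2
    linarith
  have hJ : (x : E4) ∈ Minkowski.vacuumCauchyDevelopment.metric.causalFuture
      Minkowski.vacuumCauchyDevelopment.timeOrientation
      ({E4.ofTimeSpace 0 (E4.spatial (x : E4))} : Set E4) := by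
    refine Minkowski.mem_causalFuture_vacuumCauchyDevelopment ?_
    simp only [E4.spatial_ofTimeSpace, sub_self, norm_zero, E4.ofTimeSpace_apply_zero, sub_zero]
    exact hx0
  refine LorentzianMetric.causalFuture_mono (M := Minkowski.vacuumCauchyDevelopment.carrier) ?_ hJ
  exact singleton_subset_iff.mpr ⟨⟨E4.spatial (x : E4), trivial⟩, rfl⟩

/-! ### §3 The leaves are achronal -/

/-- **The scale-`ℓ` hyperboloids of Minkowski space are achronal** (`ℓ > 0`): for `q, q'` with
`x⁰ = C + √(ℓ² + |x̲|²)`, `q' ∈ I⁺(q) ⊆ J⁺(q)` gives `‖q̲' − q̲‖ ≤ q'⁰ − q⁰ = √(ℓ²+|q̲'|²) −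
√(ℓ²+|q̲|²) ≤ |‖q̲'‖ − ‖q̲‖| ≤ ‖q̲' − q̲‖`; strictness of the middle step off `‖q̲'‖ = ‖q̲‖` forces
`q' = q`, contradicting chronology (`CauchyDevelopment.isChronological`). O'Neill 1983, Ch. 14,
p. 413. [cite: ONeillSemiRiemannian1983, Ch. 14, p. 413] -/
theorem isAchronal_hyperboloid {ℓ : ℝ} (hℓ : 0 < ℓ) (C : ℝ) :
    Minkowski.vacuumCauchyDevelopment.metric.IsAchronal
      Minkowski.vacuumCauchyDevelopment.timeOrientation
      {x : E4 | x 0 = C + √(ℓ ^ 2 + E4.spatialNorm x ^ 2)} := by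
  intro (q : E4) hq (q' : E4) hq' hI
  have hq0 : q 0 = C + √(ℓ ^ 2 + ‖E4.spatial q‖ ^ 2) := hq
  have hq'0 : q' 0 = C + √(ℓ ^ 2 + ‖E4.spatial q'‖ ^ 2) := hq'
  -- chronological ⇒ causal ⇒ inside the closed cone
  have hJ : q' ∈ Minkowski.vacuumCauchyDevelopment.metric.causalFuture
      Minkowski.vacuumCauchyDevelopment.timeOrientation ({q} : Set E4) :=
    LorentzianMetric.chronologicalFuture_subset_causalFuture
      Minkowski.vacuumCauchyDevelopment.metric Minkowski.vacuumCauchyDevelopment.timeOrientation _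
      hI
  have hcone : ‖E4.spatial q' - E4.spatial q‖ ≤ q' 0 - q 0 :=
    (Set.ext_iff.mp (Minkowski.causalFuture_singleton q) q').mp hJ
  set s := ‖E4.spatial q‖ with hs
  set s' := ‖E4.spatial q'‖ with hs'
  have hd0 : q' 0 - q 0 = √(ℓ ^ 2 + s' ^ 2) - √(ℓ ^ 2 + s ^ 2) := by rw [hq0, hq'0]; ring
  have hlip : q' 0 - q 0 ≤ |s' - s| := by
    rw [hd0]
    exact (le_abs_self _).trans (abs_sqrt_sq_add_sq_sub_le ℓ s' s)
  have hrev : |s' - s| ≤ ‖E4.spatial q' - E4.spatial q‖ := abs_norm_sub_norm_le _ _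
  have hd : q' 0 - q 0 = ‖E4.spatial q' - E4.spatial q‖ := le_antisymm (hlip.trans hrev) hcone
  have heq : ‖E4.spatial q' - E4.spatial q‖ = |s' - s| := le_antisymm (hd ▸ hlip) hrev
  have hsq : √(ℓ ^ 2 + s' ^ 2) - √(ℓ ^ 2 + s ^ 2) = |s' - s| := by rw [← hd0, hd, heq]
  have hss_eq : s' = s :=
    eq_of_sqrt_sub_sqrt_eq_abs_sub hℓ.ne' (norm_nonneg _) (norm_nonneg _) hsq
  have hsp : E4.spatial q' = E4.spatial q := by
    have : ‖E4.spatial q' - E4.spatial q‖ = 0 := by rw [heq, hss_eq, sub_self, abs_zero]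
    exact sub_eq_zero.1 (norm_eq_zero.1 this)
  have htime : E4.time q' = E4.time q := show q' 0 = q 0 by rw [hq0, hq'0, hss_eq]
  have hqq : q' = q := by
    rw [← E4.ofTimeSpace_time_spatial q', ← E4.ofTimeSpace_time_spatial q, htime, hsp]
  subst hqq
  exact Minkowski.vacuumCauchyDevelopment.toCauchyDevelopment.isChronological
    |>.not_mem_chronologicalFuture_self q' hI

/-- **The leaves `{s = s₀}` of the `0`-hole layer are achronal**: the image of `{s = s₀}` under the
inclusion lies on the hyperboloid `{x⁰ = τ + s₀ − ℓ + √(ℓ² + |x̲|²)}`, and achronality passes to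
subsets. O'Neill 1983, Ch. 14, p. 413. [folklore] -/
theorem isAchronal_image_subtypeVal_leaf {ℓ : ℝ} (hℓ : 0 < ℓ) (s₀ : ℝ) :
    Minkowski.vacuumCauchyDevelopment.metric.IsAchronal
      Minkowski.vacuumCauchyDevelopment.timeOrientation
      ((Subtype.val : RecedingKerr.layer M a Λ ξ τ ℓ → E4) ''
        {x | RecedingKerr.layerTime τ ℓ x.1 = s₀}) := by
  have hsub : (Subtype.val : RecedingKerr.layer M a Λ ξ τ ℓ → E4) ''
      {x | RecedingKerr.layerTime τ ℓ x.1 = s₀} ⊆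
        {x : E4 | x 0 = (τ + s₀ - ℓ) + √(ℓ ^ 2 + E4.spatialNorm x ^ 2)} := by
    rintro _ ⟨x, hx, rfl⟩
    have h : RecedingKerr.layerTime τ ℓ x.1 = s₀ := hx
    unfold RecedingKerr.layerTime at h
    show (x : E4) 0 = (τ + s₀ - ℓ) + √(ℓ ^ 2 + E4.spatialNorm (x : E4) ^ 2)
    linarith
  intro q hq q' hq' hI
  exact isAchronal_hyperboloid hℓ (τ + s₀ - ℓ) q (hsub hq) q' (hsub hq') hI

/-! ### §4 The thrifty hand-over of the Minkowski development -/

/-- **ANTI-VACUITY of the thrifty hand-over: the Minkowski development admits, for every scale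
`ℓ > 0`, accuracy `ε > 0` and lab time `τ₁`, an EXACT `0`-hole thrifty layer after `τ₁`** —
`FullHandoff Minkowski.vacuumCauchyDevelopment` (clause (iii) of `DerivativeThrift.ThriftyHandoff`
at the model development of the trivial datum): `N = 0` (labels, motions, velocities and centre
separation `Fin 0`-vacuous), lab time `τ = max τ₁ 0`, chart the inclusion of the layer (smooth,
`contMDiff_subtype_val`; an open embedding of an open subset), image in `J⁺(ι ℝ³)` (§2), achronal
leaves (§3), layer norm `0 ≤ ε` (§2). Hawking–Ellis 1973, §5.1; Klainerman–Szeftel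
arXiv:2104.11857, §3.1. [folklore] -/
theorem fullHandoff_minkowski : FullHandoff Minkowski.vacuumCauchyDevelopment := by
  refine ⟨0, ![], ![], ![], fun i ↦ i.elim0, fun i ↦ i.elim0, fun i ↦ i.elim0, ?_⟩
  intro ℓ hℓ ε hε τ₁
  refine ⟨max τ₁ 0, le_max_left _ _, ![],
    (Subtype.val : RecedingKerr.layer (![] : Fin 0 → ℝ) ![] ![] ![] (max τ₁ 0) ℓ → E4),
    fun i ↦ i.elim0, ?_, ?_, ?_, ?_, ?_⟩
  · -- smooth
    exact contMDiff_subtype_val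
  · -- an open embedding of the open layer
    exact (RecedingKerr.layer (![] : Fin 0 → ℝ) ![] ![] ![] (max τ₁ 0) ℓ).isOpen.isOpenEmbedding_subtypeVal
  · -- charted into `J⁺(ι ℝ³)`
    exact range_subtypeVal_layer_subset_causalFuture ![] ![] ![] ![] (le_max_right _ _)
  · -- achronal leaves
    intro s₀ _
    exact isAchronal_image_subtypeVal_leaf ![] ![] ![] ![] (max τ₁ 0) hℓ s₀
  · -- `𝔑 = 0 ≤ ε`
    rw [recedingKerrInitialLayerNorm_subtypeVal_layer]
    exact bot_le

/-- **The weak thrifty hand-over of the Minkowski development** (the conclusion of the line's stub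
`stub_censoredCapture` at the model development): from `fullHandoff_minkowski`, sub-extremal labels
being closed labels and the velocity clause being dropped (both `Fin 0`-vacuous anyway).
Hawking–Ellis 1973, §5.1. [folklore] -/
theorem weakHandoff_minkowski : WeakHandoff Minkowski.vacuumCauchyDevelopment := by
  obtain ⟨N, M, a, Λ, hsub, horth, -, h⟩ := fullHandoff_minkowski
  exact ⟨N, M, a, Λ, fun i ↦ Or.inl (hsub i), horth, h⟩

/-- **Registered sub-goal `stub_censoredCapture_minkowski` of the crux item (anti-vacuity instance of
the conclusion of `stub_censoredCapture` at the model development; not part of the line's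
composition):** the Minkowski development of the trivial datum admits a weak thrifty hand-over.
Hawking–Ellis 1973, §5.1. [folklore] -/
theorem stub_censoredCapture_minkowski :
    open Literature.Geometry.Lorentzian Summit.FinalStateConjecture.FinalStateConjecture.Theorems.DerivativeThriftThriftyHandoff in
    WeakHandoff Minkowski.vacuumCauchyDevelopment :=
  weakHandoff_minkowski

end Summit.FinalStateConjecture.FinalStateConjecture.Theorems.DerivativeThriftThriftyHandoff

end
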